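import Mathlib
import Literature.Algebra.Polynomial.MarkovLukacsTwoSquares
import Literature.Algebra.Polynomial.PolyaPositivstellensatz
import HarnessLib

/-!
# The Bernstein degree of a polynomial positive on `[−1, 1]`: certificates
# `f = Σ cₖ (1−x)ᵏ(1+x)^{N−k}`, `cₖ ≥ 0`, exist with an explicit a-priori `N`
# (Powers–Reznick 2000, §3 Theorem 6: `r(f) = n + r̃(f̃)`, with Pólya's bound)

Topic `Literature/Algebra/Polynomial`, namespace `Literature.Algebra.Polynomial.BernsteinDegree`.
Real univariate polynomials `ℝ[X]`; the Goursat transform `goursat m f` of the tree file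
`MarkovLukacs.lean` (`(goursat m f)(x) = (1 + x)ᵐ f((1 − x)/(1 + x))`, Powers–Reznick's `f̃`);
Pólya's theorem with the Powers–Reznick 2001 bound, tree file `PolyaPositivstellensatz.lean`
(`polya_powersReznick`); Mathlib's `bernsteinPolynomial`.

## Source, read on the page

V. Powers, B. Reznick, *Polynomials that are positive on an interval*, Trans. Amer. Math. Soc. 352
(2000) 4677–4692 [held text `paper:doi-10-1090-s0002-9947-00-02595-2`, pp. 4–5 and 7–8]:
* §2 eq. (5) (p. 4680): «`P_d := {Σ_{i+j≤d} c_ij (1 − x)ⁱ (1 + x)ʲ | c_ij ≥ 0}`.  Hermite asked: if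
  `p ∈ Pd([−1, 1])` has degree `d`, must it belong to `P_d`? This question was quickly answered in
  the negative, by E. Goursat … Suppose `p ∈ P_d` … then `p̃(x) = Σ 2^{i+j} c_ij xⁱ (1+x)^{d−i−j}`, so
  that the coefficients of `p̃` are nonnegative. For `ε > 0`, let `p_ε(x) = x² + ε`. We have
  `p̃_ε(x) = ε(1 + x)² + (1 − x)² = (1 + ε) − (2 − 2ε)x + (1 + ε)x²`. Clearly, if `ε > 0`, then
  `p_ε ∈ Pd([−1, 1])`. But `p_ε ∈ P_2` if and only if the coefficients of `p̃_ε` are nonnegative,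
  and this is true only for `ε ≥ 1`. Thus, for `0 < ε < 1`, `p_ε` provides a negative answer to
  Hermite's question.  However, if `p ∈ Pd([−1, 1])`, then it is true that `p ∈ P_m` for
  sufficiently large `m`. This was proved by Bernstein [1] in 1915».
* p. 4681: «if `0 ≠ p ∈ Psd([−1, 1])`, and `p(u) = 0` for `u ∈ (−1, 1)`, then upon setting `x = u`
  in the equation `p(x) = Σ c_ij (1 − x)ⁱ (1 + x)ʲ`, with `c_ij ≥ 0`, we conclude that `c_ij = 0` for
  all `(i, j)`, a contradiction.»
* §3 (p. 4683): «Suppose `f ∈ Pd([−1, 1])` has degree `m`. Define `r(f)` to be the smallest integer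
  `n` so that `f ∈ P_n`; `r(f)` has been called the Bernstein degree of `f` (by DeVore and Lorentz)
  and the Lorentz degree of `f` (by Borwein and Erdélyi) … Let `r̃(g)` denote the smallest integer `d`
  for which `(1 + x)^d g(x)` has non-negative coefficients.»  **Theorem 6.** «Suppose
  `f(x) ∈ Pd([−1, 1])` has degree `n`, and let `f̃(x) = Σ_j e_j xʲ`. Let `λ` denote the minimum of
  `f(x)` for `x ∈ [−1, 1]` and let `L` denote `max{|e_j|}`. Then `r(f) = n + r̃(f̃) ≤ 3n + ⌈2n²L/λ⌉`.»
  Proof (pp. 4683–4684): «Apply the Goursat transform (of degree `m + n`) to both sides … to obtain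
  `2^{m+n} f(x) = Σ b_k (1 − x)ᵏ (1 + x)^{m+n−k}`. Thus, `r(f) ≤ m + n`»; «a representation … with
  non-negative `c_ij` can always be homogenized … `r(f)` is always achieved by a homogeneous
  representation»; «taking the Goursat transform of degree `r ≥ n`, we get
  `Σ d_k xᵏ = 2^r (1 + x)^{r−n} f̃(x)` (6). Thus, `r̃(f̃) ≤ r(f) − n`»; «apply Proposition 4 to
  `q(x, y) = Σ b_j xʲ y^{d−j}`»; «`λ` is precisely the minimum of `f` on `[−1, 1]`».
* V. Powers, B. Reznick, *A new bound for Pólya's Theorem …*, J. Pure Appl. Algebra 164 (2001),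
  Thm 1 — the tree's `polya_powersReznick`: for a form `q` of degree `d` whose coefficients satisfy
  `|a_α| ≤ L·(multinomial α)` and `q ≥ λ` on the simplex, `(N + d)λ > L·C(d,2)` ⇒ `(Σ xᵢ)^N q` has all
  degree-`(N+d)` coefficients `> 0` (we use it with the cruder `|a_α| ≤ L`; this replaces the
  de Loera–Santos constant of Powers–Reznick 2000 Prop. 4 / Cor. 5 and gives `r(f) ≤ n + N` for
  any `N` with `(N + n)λ > n(n−1)L/2`, which implies the printed `3n + ⌈2n²L/λ⌉`).

## What is formalised (all proved; no named facts, no `sorry`)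

* §1 `bernsteinCert N c = Σ_{k≤N} cₖ (1−X)ᵏ (1+X)^{N−k}` (the homogeneous degree-`N` representation),
  `IsBernstein N f` (some `c ≥ 0`), `IsStrictBernstein N f` (some `c > 0`); the Goursat dictionary
  `goursat N g = bernsteinCert N (coeff g)` (definitional), `goursat N (bernsteinCert N c) =
  2^N Σ cₖ Xᵏ`, uniqueness of the homogeneous representation, every `f` with `deg f ≤ N` equals
  `bernsteinCert N (k ↦ coeff_k (goursat N f)/2^N)`; degree raising `P_N ⊆ P_{N+1}`
  (`IsBernstein.succ`, `.mono`) and the inhomogeneous cone `P_d` of (5)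
  («can always be homogenized»: `isBernstein_of_inhomogeneous`).
* §2 soundness: `IsBernstein N f` ⇒ `f ≥ 0` on `[−1, 1]` and (`f ≠ 0` ⇒ `f > 0` on `(−1, 1)`, the
  p. 4681 remark); `IsStrictBernstein N f` ⇒ `f > 0` on `[−1, 1]`.
* §3 **Theorem 6, first part** (`r(f) = n + r̃(f̃)` as a criterion): for `deg f ≤ n ≤ N`,
  `IsBernstein N f ⟺` all coefficients of `(1 + X)^{N−n} · goursat n f` are `≥ 0`
  (`isBernstein_iff_coeff_nonneg`, `isBernstein_iff_coeff_mul_goursat_nonneg`), and strictly.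
* §4 **Theorem 6, second part, with Pólya's bound in the Powers–Reznick 2001 form** (effective
  Bernstein / Hausdorff theorem): if `deg f ≤ n`, `f ≥ λ` on `[−1, 1]`, `|e_j| ≤ L` for the
  coefficients `e_j` of `goursat n f`, and `(N + n)·λ > L·C(n,2)`, then `IsStrictBernstein (N + n) f`
  (`isStrictBernstein_of_le_eval`) — hence `r(f) ≤ n + N`; and the printed bound
  (`isStrictBernstein_of_printed_bound`: every `r ≥ 3n + 2n²L/λ`, `r > 0`).  Proof as printed: the form
  `q = Σ e_j x₀ʲ x₁^{n−j}` (`polyaForm`) equals `f(x₁ − x₀)` on the simplex, Pólya gives positive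
  coefficients of `(x₀ + x₁)^N q`, dehomogenising (`x₀ ↦ X`, `x₁ ↦ 1`) gives
  `(1 + X)^N f̃ = goursat (N+n) f` with positive coefficients, and §3 turns this into the certificate.
* §5 Hermite's question (Goursat's example): `p_ε = X² + ε` is `> 0` on `[−1, 1]` for `ε > 0` but
  `IsBernstein 2 p_ε ⟺ 1 ≤ ε` (`isBernstein_two_sq_add_C_iff`) — «it might be necessary for `i + j`
  to exceed `deg p`»; and from §4, `IsStrictBernstein (N + 2) p_ε` as soon as `(N + 2)ε > 2`
  (`0 < ε ≤ 1`).
* §6 the Bernstein basis on `[0, 1]` (Mathlib `bernsteinPolynomial`): `g > 0` on `[0, 1]` ⇒ for all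
  sufficiently large `N`, `g = Σ_ν b_ν · bernsteinPolynomial ℝ N ν` with ALL `b_ν > 0`
  (`exists_forall_pos_bernstein_coeff`) — completeness, under degree elevation, of the Bernstein
  sign certificates of the tree file `Analysis/ValidatedNumerics/BernsteinRangeEnclosure.lean`.

## What is NOT formalised

The exact Bernstein degree of `x² + ε` (the least odd integer `≥ 1/ε`, p. 4684); §4 of the paper
(Schmüdgen's theorem for `[−1, 1]` with degree bounds, Theorem 7 / Corollary 8); Proposition 10 ff.
-/

noncomputable section

open Polynomial Finset
open scoped BigOperators

namespace Literature.Algebra.Polynomial.BernsteinDegree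

open Literature.Algebra.Polynomial.MarkovLukacs
open Literature.Algebra.Polynomial.MarkovLukacsTwoSquares

/-! ### §1 Homogeneous Bernstein–Hausdorff certificates and the Goursat dictionary -/

/-- The homogeneous degree-`N` Bernstein–Hausdorff combination
`Σ_{k ≤ N} cₖ (1 − X)ᵏ (1 + X)^{N−k}` («`r(f)` is always achieved by a homogeneous representation»).
[cite: PowersReznick2000, §2 eq. (5) (p. 4680); §3 proof of Theorem 6 (p. 4684)] -/
def bernsteinCert (N : ℕ) (c : ℕ → ℝ) : ℝ[X] :=
  ∑ k ∈ Finset.range (N + 1), C (c k) * (1 - X) ^ k * (1 + X) ^ (N - k)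

/-- `f ∈ P_N` in homogeneous form: `f = Σ_{k≤N} cₖ (1−X)ᵏ(1+X)^{N−k}` with all `cₖ ≥ 0`
(Powers–Reznick's `P_d`, (5), homogenised). [cite: PowersReznick2000, §2 eq. (5) (p. 4680)] -/
def IsBernstein (N : ℕ) (f : ℝ[X]) : Prop :=
  ∃ c : ℕ → ℝ, (∀ k ≤ N, 0 ≤ c k) ∧ f = bernsteinCert N c

/-- The strict version: all `cₖ > 0` (the conclusion of Pólya / Bernstein for `f > 0`).
[cite: PowersReznick2000, §3 Proposition 4 and Theorem 6 (p. 4683)] -/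
def IsStrictBernstein (N : ℕ) (f : ℝ[X]) : Prop :=
  ∃ c : ℕ → ℝ, (∀ k ≤ N, 0 < c k) ∧ f = bernsteinCert N c

/-- Strict certificates are certificates. [cite: PowersReznick2000, §2 eq. (5) (p. 4680)] -/
theorem IsStrictBernstein.isBernstein {N : ℕ} {f : ℝ[X]} (h : IsStrictBernstein N f) :
    IsBernstein N f := by
  obtain ⟨c, hc, hf⟩ := h
  exact ⟨c, fun k hk => (hc k hk).le, hf⟩

/-- **The Goursat transform IS a Bernstein combination**: `goursat N g = Σ_{k≤N} g_k (1−X)ᵏ(1+X)^{N−k}`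
(definition (3) of the transform written in the basis (5)). [cite: PowersReznick2000, §2 eq. (3)
(p. 4680); §3 proof of Theorem 6, eq. (6) (p. 4684)] -/
theorem goursat_eq_bernsteinCert (N : ℕ) (g : ℝ[X]) :
    goursat N g = bernsteinCert N (fun k => g.coeff k) := rfl

/-- `bernsteinCert` is homogeneous in the coefficients. [folklore] -/
private theorem bernsteinCert_smul (N : ℕ) (a : ℝ) (c : ℕ → ℝ) :
    bernsteinCert N (fun k => a * c k) = C a * bernsteinCert N c := by
  simp only [bernsteinCert, map_mul, Finset.mul_sum, mul_assoc]

/-- `bernsteinCert N c` depends only on `c 0, …, c N`. [folklore] -/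
private theorem bernsteinCert_congr {N : ℕ} {c c' : ℕ → ℝ} (h : ∀ k ≤ N, c k = c' k) :
    bernsteinCert N c = bernsteinCert N c' :=
  Finset.sum_congr rfl fun k hk => by rw [h k (Nat.lt_succ_iff.mp (Finset.mem_range.mp hk))]

/-- The coefficients of `Σ_{k≤N} cₖ Xᵏ`. [folklore] -/
private theorem coeff_sum_C_mul_X_pow (N : ℕ) (c : ℕ → ℝ) (j : ℕ) :
    (∑ k ∈ Finset.range (N + 1), C (c k) * X ^ k).coeff j = if j ≤ N then c j else 0 := by
  rw [finsetSum_coeff]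
  simp only [coeff_C_mul_X_pow]
  rw [Finset.sum_ite_eq (Finset.range (N + 1)) j c]
  simp only [Finset.mem_range, Nat.lt_succ_iff]

/-- `Σ_{k≤N} cₖ Xᵏ` has degree `≤ N`. [folklore] -/
private theorem natDegree_sum_C_mul_X_pow_le (N : ℕ) (c : ℕ → ℝ) :
    (∑ k ∈ Finset.range (N + 1), C (c k) * X ^ k).natDegree ≤ N :=
  natDegree_sum_le_of_forall_le _ _ fun _ hk =>
    (natDegree_C_mul_X_pow_le _ _).trans (Nat.lt_succ_iff.mp (Finset.mem_range.mp hk))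

/-- `bernsteinCert N c` is the Goursat transform of `Σ_{k≤N} cₖ Xᵏ`. [cite: PowersReznick2000, §3
proof of Theorem 6, eq. (6) (p. 4684)] -/
theorem bernsteinCert_eq_goursat (N : ℕ) (c : ℕ → ℝ) :
    bernsteinCert N c = goursat N (∑ k ∈ Finset.range (N + 1), C (c k) * X ^ k) := by
  rw [goursat_eq_bernsteinCert]
  exact bernsteinCert_congr fun k hk => by rw [coeff_sum_C_mul_X_pow, if_pos hk]

/-- `deg (bernsteinCert N c) ≤ N`. [cite: PowersReznick2000, §2 eq. (5) (p. 4680)] -/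
theorem natDegree_bernsteinCert_le (N : ℕ) (c : ℕ → ℝ) : (bernsteinCert N c).natDegree ≤ N := by
  rw [bernsteinCert_eq_goursat]
  exact natDegree_goursat_le _ _

/-- **Goursat's computation**: `goursat N (Σ cₖ (1−X)ᵏ(1+X)^{N−k}) = 2^N Σ cₖ Xᵏ` («taking the
Goursat transform of degree `r` … we get `Σ d_k xᵏ = 2^r …`», eq. (6)).
[cite: PowersReznick2000, §2 p. 4680 («so that the coefficients of `p̃` are nonnegative»); §3
eq. (6) (p. 4684)] -/
theorem goursat_bernsteinCert (N : ℕ) (c : ℕ → ℝ) :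
    goursat N (bernsteinCert N c) =
      C ((2 : ℝ) ^ N) * ∑ k ∈ Finset.range (N + 1), C (c k) * X ^ k := by
  rw [bernsteinCert_eq_goursat, goursat_goursat (natDegree_sum_C_mul_X_pow_le N c)]

/-- Hence the coefficients of a homogeneous degree-`N` representation are determined by `f`:
`coeff_k (goursat N f) = 2^N cₖ`. [cite: PowersReznick2000, §3 eq. (6) (p. 4684)] -/
theorem coeff_goursat_of_eq_bernsteinCert {N : ℕ} {c : ℕ → ℝ} {f : ℝ[X]}
    (hf : f = bernsteinCert N c) {k : ℕ} (hk : k ≤ N) : (goursat N f).coeff k = 2 ^ N * c k := by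
  rw [hf, goursat_bernsteinCert, coeff_C_mul, coeff_sum_C_mul_X_pow, if_pos hk]

/-- **Uniqueness of the homogeneous representation** (`(1−X)ᵏ(1+X)^{N−k}`, `k ≤ N`, is a basis of
`ℝ[X]_{≤N}`). [cite: PowersReznick2000, §3 eq. (6) (p. 4684)] -/
theorem bernsteinCert_inj {N : ℕ} {c c' : ℕ → ℝ} (h : bernsteinCert N c = bernsteinCert N c')
    {k : ℕ} (hk : k ≤ N) : c k = c' k := by
  have h1 := coeff_goursat_of_eq_bernsteinCert (f := bernsteinCert N c) rfl hk
  have h2 := coeff_goursat_of_eq_bernsteinCert h hk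
  exact mul_left_cancel₀ (pow_ne_zero _ two_ne_zero) (h1.symm.trans h2)

/-- **Every polynomial of degree `≤ N` has a (signed) homogeneous degree-`N` representation, with
coefficients `cₖ = coeff_k (goursat N f) / 2^N`** (the inversion (4) `f̃̃ = 2^N f`).
[cite: PowersReznick2000, §2 eq. (4) (p. 4680); §3 proof of Theorem 6 (pp. 4683–4684)] -/
theorem eq_bernsteinCert_coeff_goursat {N : ℕ} {f : ℝ[X]} (hf : f.natDegree ≤ N) :
    f = bernsteinCert N (fun k => (goursat N f).coeff k / 2 ^ N) := by
  have h2 : (2 : ℝ) ^ N ≠ 0 := pow_ne_zero _ two_ne_zero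
  have h := goursat_goursat hf
  rw [goursat_eq_bernsteinCert N (goursat N f)] at h
  have : bernsteinCert N (fun k => (goursat N f).coeff k / 2 ^ N) =
      C ((2 : ℝ) ^ N)⁻¹ * bernsteinCert N (fun k => (goursat N f).coeff k) := by
    rw [← bernsteinCert_smul]
    exact bernsteinCert_congr fun k _ => by rw [div_eq_inv_mul]
  rw [this, h, ← mul_assoc, ← map_mul, inv_mul_cancel₀ h2, map_one, one_mul]

/-- `goursat (N + 1) g = (1 + X) · goursat N g` for `deg g ≤ N`. [cite: PowersReznick2000, §2
eq. (3) (p. 4680)] -/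
theorem goursat_succ {N : ℕ} {g : ℝ[X]} (hg : g.natDegree ≤ N) :
    goursat (N + 1) g = (1 + X) * goursat N g := by
  apply eq_of_infinite_eval_eq
  apply (Set.Ioi_infinite (0 : ℝ)).mono
  rintro x (hx : 0 < x)
  have h1 : (1 : ℝ) + x ≠ 0 := by positivity
  show eval x _ = eval x _
  rw [eval_goursat (hg.trans N.le_succ) h1, eval_mul, eval_goursat hg h1, eval_add, eval_one,
    eval_X, pow_succ]
  ring

/-- More generally `goursat (N + n) g = (1 + X)^N · goursat n g` for `deg g ≤ n`: the homogeneous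
representations of all degrees `≥ n` are read off `(1 + x)^{r−n} g̃` (eq. (6)).
[cite: PowersReznick2000, §3 Theorem 6 and eq. (6) (pp. 4683–4684)] -/
theorem goursat_add_eq_pow_mul_goursat {n : ℕ} {g : ℝ[X]} (hg : g.natDegree ≤ n) (N : ℕ) :
    goursat (N + n) g = (1 + X) ^ N * goursat n g := by
  induction N with
  | zero => rw [Nat.zero_add, pow_zero, one_mul]
  | succ N ih =>
    rw [show N + 1 + n = (N + n) + 1 by ring, goursat_succ (hg.trans (Nat.le_add_left n N)), ih,
      pow_succ]
    ring

/-- **Degree raising** `P_N ⊆ P_{N+1}`, with explicit coefficients: `(1−X)ᵏ(1+X)^{N−k} =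
½(1−X)^{k+1}(1+X)^{N−k} + ½(1−X)ᵏ(1+X)^{N+1−k}`, so the degree-`(N+1)` coefficients are
`(cₖ + c_{k−1})/2` (with `c_{−1} = c_{N+1} = 0`) («can always be homogenized»).
[cite: PowersReznick2000, §3 proof of Theorem 6 (p. 4684)] -/
theorem bernsteinCert_eq_succ (N : ℕ) (c : ℕ → ℝ) :
    bernsteinCert N c = bernsteinCert (N + 1)
      (fun k => ((if k ≤ N then c k else 0) + (if k = 0 then 0 else c (k - 1))) / 2) := by
  have hdeg : (bernsteinCert N c).natDegree ≤ N + 1 := (natDegree_bernsteinCert_le N c).trans N.le_succ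
  rw [eq_bernsteinCert_coeff_goursat hdeg]
  refine bernsteinCert_congr fun k hk => ?_
  rw [goursat_succ (natDegree_bernsteinCert_le N c), goursat_bernsteinCert, ← mul_assoc,
    mul_comm (1 + X : ℝ[X]), mul_assoc, coeff_C_mul, add_mul, one_mul, coeff_add, pow_succ]
  rcases k with _ | j
  · rw [coeff_X_mul_zero, coeff_sum_C_mul_X_pow, if_pos (Nat.zero_le _)]
    simp only [if_true]
    field_simp
  · rw [coeff_X_mul, coeff_sum_C_mul_X_pow, coeff_sum_C_mul_X_pow]
    simp only [Nat.succ_ne_zero, if_false, Nat.add_sub_cancel]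
    rw [if_pos (show j ≤ N by omega)]
    field_simp

/-- `P_N ⊆ P_{N+1}`. [cite: PowersReznick2000, §3 proof of Theorem 6 (p. 4684)] -/
theorem IsBernstein.succ {N : ℕ} {f : ℝ[X]} (h : IsBernstein N f) : IsBernstein (N + 1) f := by
  obtain ⟨c, hc, rfl⟩ := h
  refine ⟨_, fun k hk => ?_, bernsteinCert_eq_succ N c⟩
  have h1 : 0 ≤ (if k ≤ N then c k else 0) := by
    split_ifs with h
    · exact hc k h
    · exact le_rfl
  have h2 : 0 ≤ (if k = 0 then 0 else c (k - 1)) := by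
    split_ifs with h
    · exact le_rfl
    · exact hc (k - 1) (by omega)
  positivity

/-- `P_N ⊆ P_M` for `N ≤ M`. [cite: PowersReznick2000, §3 proof of Theorem 6 (p. 4684)] -/
theorem IsBernstein.mono {N M : ℕ} (hNM : N ≤ M) {f : ℝ[X]} (h : IsBernstein N f) :
    IsBernstein M f := by
  obtain ⟨d, rfl⟩ := Nat.exists_eq_add_of_le hNM
  induction d with
  | zero => simpa using h
  | succ d ih => exact (ih (Nat.le_add_right N d)).succ

/-- Strict certificates also raise: the degree-`(N+1)` coefficients `(cₖ + c_{k−1})/2` are `> 0`.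
[cite: PowersReznick2000, §3 proof of Theorem 6 (p. 4684)] -/
theorem IsStrictBernstein.succ {N : ℕ} {f : ℝ[X]} (h : IsStrictBernstein N f) :
    IsStrictBernstein (N + 1) f := by
  obtain ⟨c, hc, rfl⟩ := h
  refine ⟨_, fun k hk => ?_, bernsteinCert_eq_succ N c⟩
  rcases Nat.eq_zero_or_pos k with rfl | hkpos
  · simp only [Nat.zero_le, if_true]
    linarith [hc 0 (Nat.zero_le _)]
  · rw [if_neg hkpos.ne']
    have h2 : 0 < c (k - 1) := hc (k - 1) (by omega)
    have h1 : 0 ≤ (if k ≤ N then c k else 0) := by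
      split_ifs with h
      · exact (hc k h).le
      · exact le_rfl
    positivity

/-- The basis element `(1−X)ⁱ(1+X)ʲ` lies in the homogeneous cone of degree `i + j`.
[cite: PowersReznick2000, §2 eq. (5) (p. 4680)] -/
theorem isBernstein_basis (i j : ℕ) : IsBernstein (i + j) ((1 - X) ^ i * (1 + X) ^ j) := by
  refine ⟨fun k => if k = i then 1 else 0, fun k _ => by by_cases h : k = i <;> simp [h], ?_⟩
  rw [bernsteinCert, Finset.sum_eq_single_of_mem i (Finset.mem_range.2 (by omega))
    (fun k _ hki => by rw [if_neg hki, map_zero, zero_mul, zero_mul])]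
  rw [if_pos rfl, map_one, one_mul, Nat.add_sub_cancel_left]

/-- The homogeneous cone is closed under addition. [cite: PowersReznick2000, §2 eq. (5) (p. 4680)] -/
theorem IsBernstein.add {N : ℕ} {f g : ℝ[X]} (hf : IsBernstein N f) (hg : IsBernstein N g) :
    IsBernstein N (f + g) := by
  obtain ⟨c, hc, rfl⟩ := hf
  obtain ⟨c', hc', rfl⟩ := hg
  refine ⟨fun k => c k + c' k, fun k hk => add_nonneg (hc k hk) (hc' k hk), ?_⟩
  simp only [bernsteinCert, map_add, add_mul, Finset.sum_add_distrib]

/-- … and under multiplication by nonnegative constants. [cite: PowersReznick2000, §2 eq. (5)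
(p. 4680)] -/
theorem IsBernstein.const_mul {N : ℕ} {f : ℝ[X]} (hf : IsBernstein N f) {a : ℝ} (ha : 0 ≤ a) :
    IsBernstein N (C a * f) := by
  obtain ⟨c, hc, rfl⟩ := hf
  exact ⟨fun k => a * c k, fun k hk => mul_nonneg ha (hc k hk), (bernsteinCert_smul N a c).symm⟩

/-- `0 ∈ P_N`. [cite: PowersReznick2000, §2 eq. (5) (p. 4680)] -/
theorem isBernstein_zero (N : ℕ) : IsBernstein N 0 :=
  ⟨fun _ => 0, fun _ _ => le_rfl, by simp [bernsteinCert]⟩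

/-- **The inhomogeneous cone `P_d` of (5) is contained in the homogeneous one** («a representation
`f(x) = Σ_{i+j≤d} c_ij (1 − x)ⁱ(1 + x)ʲ` with non-negative `c_ij` can always be homogenized»):
multiply each term by powers of `((1 − x) + (1 + x))/2 = 1`.
[cite: PowersReznick2000, §3 proof of Theorem 6 (p. 4684); §2 eq. (5) (p. 4680)] -/
theorem isBernstein_of_inhomogeneous {d : ℕ} {S : Finset (ℕ × ℕ)} {c : ℕ × ℕ → ℝ}
    (hS : ∀ ij ∈ S, ij.1 + ij.2 ≤ d) (hc : ∀ ij ∈ S, 0 ≤ c ij) :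
    IsBernstein d (∑ ij ∈ S, C (c ij) * (1 - X) ^ ij.1 * (1 + X) ^ ij.2) := by
  classical
  induction S using Finset.induction_on with
  | empty => simpa using isBernstein_zero d
  | insert a S haS ih =>
    rw [Finset.sum_insert haS]
    refine IsBernstein.add ?_ (ih (fun ij hij => hS ij (Finset.mem_insert_of_mem hij))
      (fun ij hij => hc ij (Finset.mem_insert_of_mem hij)))
    rw [mul_assoc]
    exact ((isBernstein_basis a.1 a.2).mono (hS a (Finset.mem_insert_self a S))).const_mul
      (hc a (Finset.mem_insert_self a S))

/-! ### §2 Soundness: certificates imply nonnegativity / positivity -/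

/-- The basis elements are nonnegative on `[−1, 1]`. [folklore] -/
private theorem basis_eval_nonneg (k m : ℕ) {x : ℝ} (hx : x ∈ Set.Icc (-1 : ℝ) 1) :
    0 ≤ ((1 - X : ℝ[X]) ^ k * (1 + X) ^ m).eval x := by
  rw [eval_mul, eval_pow, eval_pow, eval_sub, eval_add, eval_one, eval_X]
  exact mul_nonneg (pow_nonneg (by linarith [hx.2]) _) (pow_nonneg (by linarith [hx.1]) _)

/-- The basis elements are positive on `(−1, 1)`. [folklore] -/
private theorem basis_eval_pos (k m : ℕ) {x : ℝ} (hx : x ∈ Set.Ioo (-1 : ℝ) 1) :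
    0 < ((1 - X : ℝ[X]) ^ k * (1 + X) ^ m).eval x := by
  rw [eval_mul, eval_pow, eval_pow, eval_sub, eval_add, eval_one, eval_X]
  exact mul_pos (pow_pos (by linarith [hx.2]) _) (pow_pos (by linarith [hx.1]) _)

/-- Evaluation of a certificate. [folklore] -/
private theorem eval_bernsteinCert (N : ℕ) (c : ℕ → ℝ) (x : ℝ) :
    (bernsteinCert N c).eval x =
      ∑ k ∈ Finset.range (N + 1), c k * ((1 - X : ℝ[X]) ^ k * (1 + X) ^ (N - k)).eval x := by
  rw [bernsteinCert, eval_finsetSum]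
  refine Finset.sum_congr rfl fun k _ => ?_
  rw [mul_assoc, eval_mul, eval_C]

/-- **Soundness**: `f ∈ P_N ⇒ f ≥ 0` on `[−1, 1]`. [cite: PowersReznick2000, §2 (p. 4681)] -/
theorem IsBernstein.eval_nonneg {N : ℕ} {f : ℝ[X]} (h : IsBernstein N f) {x : ℝ}
    (hx : x ∈ Set.Icc (-1 : ℝ) 1) : 0 ≤ f.eval x := by
  obtain ⟨c, hc, rfl⟩ := h
  rw [eval_bernsteinCert]
  exact Finset.sum_nonneg fun k hk =>
    mul_nonneg (hc k (Nat.lt_succ_iff.mp (Finset.mem_range.mp hk))) (basis_eval_nonneg _ _ hx)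

/-- **Strict certificates give strict positivity on the CLOSED interval**: at `x = 1` the term
`c₀ (1+x)^N` survives, at `x = −1` the term `c_N (1−x)^N`. [cite: PowersReznick2000, §2 Lemma 1 and
§3 Theorem 6 (pp. 4680, 4683)] -/
theorem IsStrictBernstein.eval_pos {N : ℕ} {f : ℝ[X]} (h : IsStrictBernstein N f) {x : ℝ}
    (hx : x ∈ Set.Icc (-1 : ℝ) 1) : 0 < f.eval x := by
  obtain ⟨c, hc, rfl⟩ := h
  rw [eval_bernsteinCert]
  refine Finset.sum_pos' (fun k hk => mul_nonneg (hc k (Nat.lt_succ_iff.mp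
    (Finset.mem_range.mp hk))).le (basis_eval_nonneg _ _ hx)) ?_
  rcases eq_or_lt_of_le hx.1 with hx1 | hx1
  · -- `x = −1`: the term `k = N`
    refine ⟨N, Finset.mem_range.2 (Nat.lt_succ_self N), mul_pos (hc N le_rfl) ?_⟩
    rw [← hx1, eval_mul, eval_pow, eval_pow, eval_sub, eval_add, eval_one, eval_X, Nat.sub_self,
      pow_zero, mul_one]
    norm_num
  · -- `x > −1`: the term `k = 0`
    refine ⟨0, Finset.mem_range.2 (Nat.succ_pos N), mul_pos (hc 0 (Nat.zero_le N)) ?_⟩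
    rw [eval_mul, eval_pow, eval_pow, eval_sub, eval_add, eval_one, eval_X, pow_zero, one_mul]
    exact pow_pos (by linarith) _

/-- **A nonzero `f ∈ P_N` is strictly positive on the open interval**: «if `0 ≠ p` … and `p(u) = 0`
for `u ∈ (−1, 1)`, then … `c_ij = 0` for all `(i, j)`, a contradiction».
[cite: PowersReznick2000, §2 (p. 4681)] -/
theorem IsBernstein.eval_pos_of_ne_zero {N : ℕ} {f : ℝ[X]} (h : IsBernstein N f) (hf : f ≠ 0)
    {u : ℝ} (hu : u ∈ Set.Ioo (-1 : ℝ) 1) : 0 < f.eval u := by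
  obtain ⟨c, hc, rfl⟩ := h
  have hnn : ∀ k ∈ Finset.range (N + 1),
      0 ≤ c k * ((1 - X : ℝ[X]) ^ k * (1 + X) ^ (N - k)).eval u := fun k hk =>
    mul_nonneg (hc k (Nat.lt_succ_iff.mp (Finset.mem_range.mp hk))) (basis_eval_pos _ _ hu).le
  have h0 : 0 ≤ (bernsteinCert N c).eval u := by rw [eval_bernsteinCert]; exact Finset.sum_nonneg hnn
  rcases h0.lt_or_eq with hlt | heq
  · exact hlt
  exfalso
  apply hf
  rw [eval_bernsteinCert] at heq
  have hzero := (Finset.sum_eq_zero_iff_of_nonneg hnn).1 heq.symm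
  have hck : ∀ k ≤ N, c k = 0 := fun k hk => by
    have := hzero k (Finset.mem_range.2 (Nat.lt_succ_of_le hk))
    rcases mul_eq_zero.1 this with h1 | h1
    · exact h1
    · exact absurd h1 (basis_eval_pos _ _ hu).ne'
  rw [bernsteinCert_congr (c' := fun _ => 0) (fun k hk => hck k hk)]
  simp [bernsteinCert]

/-! ### §3 Theorem 6, first part: `r(f) = n + r̃(f̃)` as a criterion -/

/-- **`f ∈ P_N` (homogeneous, `deg f ≤ N`) iff the Goursat transform `goursat N f` has nonnegative
coefficients** («`p ∈ P_2` if and only if the coefficients of `p̃` are nonnegative», and eq. (6) in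
general). [cite: PowersReznick2000, §2 (p. 4680); §3 Theorem 6, eq. (6) (p. 4684)] -/
theorem isBernstein_iff_coeff_nonneg {N : ℕ} {f : ℝ[X]} (hf : f.natDegree ≤ N) :
    IsBernstein N f ↔ ∀ k ≤ N, 0 ≤ (goursat N f).coeff k := by
  constructor
  · rintro ⟨c, hc, hfc⟩ k hk
    rw [coeff_goursat_of_eq_bernsteinCert hfc hk]
    exact mul_nonneg (pow_nonneg zero_le_two _) (hc k hk)
  · intro h
    exact ⟨_, fun k hk => div_nonneg (h k hk) (pow_nonneg zero_le_two _),
      eq_bernsteinCert_coeff_goursat hf⟩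

/-- Strict version: `IsStrictBernstein N f` iff all coefficients `coeff_k (goursat N f)`, `k ≤ N`,
are `> 0`. [cite: PowersReznick2000, §3 Theorem 6, eq. (6) (p. 4684)] -/
theorem isStrictBernstein_iff_coeff_pos {N : ℕ} {f : ℝ[X]} (hf : f.natDegree ≤ N) :
    IsStrictBernstein N f ↔ ∀ k ≤ N, 0 < (goursat N f).coeff k := by
  constructor
  · rintro ⟨c, hc, hfc⟩ k hk
    rw [coeff_goursat_of_eq_bernsteinCert hfc hk]
    exact mul_pos (pow_pos two_pos _) (hc k hk)
  · intro h
    exact ⟨_, fun k hk => div_pos (h k hk) (pow_pos two_pos _), eq_bernsteinCert_coeff_goursat hf⟩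

/-- **Theorem 6, first part — `r(f) = n + r̃(f̃)`**: for `deg f ≤ n ≤ r`, `f` has a (homogeneous)
degree-`r` representation with nonnegative coefficients iff `(1 + x)^{r−n} f̃(x)` has nonnegative
coefficients, `f̃ = goursat n f` («`Σ d_k xᵏ = 2^r (1 + x)^{r−n} f̃(x)` (6). Thus, `r̃(f̃) ≤ r(f) − n`»
and conversely «`r(f) ≤ m + n`»). [cite: PowersReznick2000, §3 Theorem 6 and its proof, eq. (6)
(pp. 4683–4684)] -/
theorem isBernstein_iff_coeff_mul_goursat_nonneg {n N : ℕ} {f : ℝ[X]} (hf : f.natDegree ≤ n) :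
    IsBernstein (N + n) f ↔ ∀ k ≤ N + n, 0 ≤ ((1 + X) ^ N * goursat n f).coeff k := by
  rw [isBernstein_iff_coeff_nonneg (hf.trans (Nat.le_add_left n N)),
    goursat_add_eq_pow_mul_goursat hf]

/-- The strict analogue of `r(f) = n + r̃(f̃)`. [cite: PowersReznick2000, §3 Theorem 6, eq. (6)
(pp. 4683–4684)] -/
theorem isStrictBernstein_iff_coeff_mul_goursat_pos {n N : ℕ} {f : ℝ[X]} (hf : f.natDegree ≤ n) :
    IsStrictBernstein (N + n) f ↔ ∀ k ≤ N + n, 0 < ((1 + X) ^ N * goursat n f).coeff k := by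
  rw [isStrictBernstein_iff_coeff_pos (hf.trans (Nat.le_add_left n N)),
    goursat_add_eq_pow_mul_goursat hf]

/-! ### §4 Theorem 6, second part: Pólya's bound makes Bernstein's theorem effective -/

/-- **The binary form `q(x₀, x₁) = Σ_{j≤n} e_j x₀ʲ x₁^{n−j}`** attached to `g = Σ e_j xʲ` («apply
Proposition 4 to `q(x, y) = Σ b_j xʲ y^{d−j}`»). [cite: PowersReznick2000, §3 proof of Corollary 5
(p. 4683)] -/
def polyaForm (n : ℕ) (g : ℝ[X]) : MvPolynomial (Fin 2) ℝ :=
  ∑ j ∈ Finset.range (n + 1),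
    MvPolynomial.C (g.coeff j) * MvPolynomial.X 0 ^ j * MvPolynomial.X 1 ^ (n - j)

/-- The exponent vector `(a, b)` on `Fin 2`. [folklore] -/
private def expo (a b : ℕ) : Fin 2 →₀ ℕ := Finsupp.single 0 a + Finsupp.single 1 b

/-- [folklore] -/
@[simp] private theorem expo_zero (a b : ℕ) : expo a b 0 = a := by
  simp [expo]

/-- [folklore] -/
@[simp] private theorem expo_one (a b : ℕ) : expo a b 1 = b := by
  simp [expo]

/-- [folklore] -/
private theorem degree_expo (a b : ℕ) : (expo a b).degree = a + b := by
  rw [expo, map_add, Finsupp.degree_single, Finsupp.degree_single]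

/-- Every exponent vector on `Fin 2` is `expo (β 0) (β 1)`. [folklore] -/
private theorem eq_expo (β : Fin 2 →₀ ℕ) : β = expo (β 0) (β 1) := by
  ext i
  fin_cases i
  · exact (expo_zero _ _).symm
  · exact (expo_one _ _).symm

/-- `|β| = β 0 + β 1` on `Fin 2`. [folklore] -/
private theorem degree_fin_two (β : Fin 2 →₀ ℕ) : β.degree = β 0 + β 1 := by
  conv_lhs => rw [eq_expo β]
  exact degree_expo _ _

/-- The monomial form of the terms of `polyaForm`. [folklore] -/
private theorem C_mul_X_pow_mul_X_pow (a : ℝ) (j m : ℕ) :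
    (MvPolynomial.C a * MvPolynomial.X 0 ^ j * MvPolynomial.X 1 ^ m : MvPolynomial (Fin 2) ℝ) =
      MvPolynomial.monomial (expo j m) a := by
  rw [MvPolynomial.C_mul_X_pow_eq_monomial, MvPolynomial.X_pow_eq_monomial,
    MvPolynomial.monomial_mul, mul_one]
  rfl

/-- `polyaForm n g` is a form of degree `n`. [cite: PowersReznick2000, §3 Proposition 4 (p. 4683)] -/
theorem isHomogeneous_polyaForm (n : ℕ) (g : ℝ[X]) : (polyaForm n g).IsHomogeneous n := by
  refine MvPolynomial.IsHomogeneous.sum _ _ _ fun j hj => ?_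
  rw [C_mul_X_pow_mul_X_pow]
  exact MvPolynomial.isHomogeneous_monomial _ (by
    rw [degree_expo]; have := Nat.lt_succ_iff.mp (Finset.mem_range.mp hj); omega)

/-- The coefficients of `polyaForm n g`: `e_{β₀}` on the exponents of degree `n`, `0` elsewhere.
[cite: PowersReznick2000, §3 proof of Corollary 5 (p. 4683)] -/
theorem coeff_polyaForm (n : ℕ) (g : ℝ[X]) (β : Fin 2 →₀ ℕ) :
    MvPolynomial.coeff β (polyaForm n g) = if β 0 + β 1 = n then g.coeff (β 0) else 0 := by
  classical
  rw [polyaForm, MvPolynomial.coeff_sum]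
  simp only [C_mul_X_pow_mul_X_pow, MvPolynomial.coeff_monomial]
  split_ifs with h
  · rw [Finset.sum_eq_single_of_mem (β 0) (Finset.mem_range.2 (by omega))]
    · rw [if_pos]
      rw [eq_expo β]
      simp only [expo_zero]
      congr 1; omega
    · intro j _ hj
      rw [if_neg]
      intro hβ
      apply hj
      have := congr_arg (fun γ : Fin 2 →₀ ℕ => γ 0) hβ
      simpa using this
  · refine Finset.sum_eq_zero fun j hj => ?_
    rw [if_neg]
    intro hβ
    apply h
    have h0 := congr_arg (fun γ : Fin 2 →₀ ℕ => γ 0) hβ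
    have h1 := congr_arg (fun γ : Fin 2 →₀ ℕ => γ 1) hβ
    simp only [expo_zero, expo_one] at h0 h1
    have := Nat.lt_succ_iff.mp (Finset.mem_range.mp hj)
    omega

/-- Pólya's coefficient hypothesis for `polyaForm`: `|e_j| ≤ L` gives `|a_β| ≤ L·(multinomial β)`.
[cite: PowersReznick2000, §3 Proposition 4 / Corollary 5 (p. 4683)] -/
theorem abs_coeff_polyaForm_le {n : ℕ} {g : ℝ[X]} {L : ℝ} (hL : ∀ j, |g.coeff j| ≤ L)
    (β : Fin 2 →₀ ℕ) : |MvPolynomial.coeff β (polyaForm n g)| ≤ L * (β.multinomial : ℝ) := by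
  have hL0 : 0 ≤ L := (abs_nonneg _).trans (hL 0)
  have hm : (1 : ℝ) ≤ (β.multinomial : ℝ) := by
    rw [Finsupp.multinomial_eq]
    exact_mod_cast Nat.multinomial_pos _ _
  rw [coeff_polyaForm]
  split_ifs
  · exact (hL _).trans (le_mul_of_one_le_right hL0 hm)
  · rw [abs_zero]; positivity

/-- Evaluation of the form. [cite: PowersReznick2000, §3 proof of Corollary 5 (p. 4683)] -/
theorem eval_polyaForm (n : ℕ) (g : ℝ[X]) (u : Fin 2 → ℝ) :
    MvPolynomial.eval u (polyaForm n g) =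
      ∑ j ∈ Finset.range (n + 1), g.coeff j * u 0 ^ j * u 1 ^ (n - j) := by
  rw [polyaForm, map_sum]
  refine Finset.sum_congr rfl fun j _ => ?_
  rw [map_mul, map_mul, map_pow, map_pow, MvPolynomial.eval_C, MvPolynomial.eval_X,
    MvPolynomial.eval_X]

/-- **The form recovers `f` on the simplex**: for `deg f ≤ n` and `u₀ + u₁ = 1`,
`q_{f̃}(u₀, u₁) = f(u₁ − u₀)` — this is «`(1 − t)^d f̃(t/(1−t)) = f(1 − 2t)`, so that `λ` is precisely
the minimum of `f` on `[−1, 1]`», homogenised. [cite: PowersReznick2000, §3 proof of Theorem 6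
(p. 4684)] -/
theorem eval_polyaForm_goursat {n : ℕ} {f : ℝ[X]} (hf : f.natDegree ≤ n) {u : Fin 2 → ℝ}
    (hu : u 0 + u 1 = 1) : MvPolynomial.eval u (polyaForm n (goursat n f)) = f.eval (u 1 - u 0) := by
  rw [eval_polyaForm]
  by_cases h1 : u 1 = 0
  · -- the vertex `(1, 0)`: only the term `j = n` survives, and `e_n = f(−1)`
    have h0 : u 0 = 1 := by linarith
    rw [Finset.sum_eq_single_of_mem n (Finset.mem_range.2 (Nat.lt_succ_self n))]
    · rw [h0, h1, Nat.sub_self, pow_zero, one_pow, mul_one, mul_one, coeff_goursat_self hf]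
      norm_num
    · intro j hj hjn
      have hjn' : j < n := lt_of_le_of_ne (Nat.lt_succ_iff.mp (Finset.mem_range.mp hj)) hjn
      rw [h1, zero_pow (by omega), mul_zero]
  · -- generic point: `2ⁿ f(t) = (1+t)ⁿ f̃((1−t)/(1+t))` with `t = u₁ − u₀`, `1 + t = 2u₁`
    have ht : 1 + (u 1 - u 0) = 2 * u 1 := by linarith
    have hne : 1 + (u 1 - u 0) ≠ 0 := by rw [ht]; exact mul_ne_zero two_ne_zero h1
    have key := two_pow_mul_eval hf hne
    have hrat : (1 - (u 1 - u 0)) / (1 + (u 1 - u 0)) = u 0 / u 1 := by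
      rw [ht, show 1 - (u 1 - u 0) = 2 * u 0 by linarith]
      field_simp
    rw [hrat, ht, mul_pow] at key
    have key' : f.eval (u 1 - u 0) = u 1 ^ n * (goursat n f).eval (u 0 / u 1) := by
      apply mul_left_cancel₀ (pow_ne_zero n (two_ne_zero (α := ℝ)))
      rw [key]; ring
    rw [key', eval_eq_sum_range' (Nat.lt_succ_of_le (natDegree_goursat_le n f)), Finset.mul_sum]
    refine Finset.sum_congr rfl fun j hj => ?_
    have hjn : j ≤ n := Nat.lt_succ_iff.mp (Finset.mem_range.mp hj)
    obtain ⟨m, hm⟩ := Nat.exists_eq_add_of_le hjn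
    rw [hm, Nat.add_sub_cancel_left, pow_add, div_pow]
    field_simp

/-- The dehomogenisation `x₀ ↦ X`, `x₁ ↦ 1`. [folklore] -/
private def dehom : MvPolynomial (Fin 2) ℝ →ₐ[ℝ] ℝ[X] :=
  MvPolynomial.aeval ![(X : ℝ[X]), 1]

/-- [folklore] -/
private theorem dehom_X_zero : dehom (MvPolynomial.X 0) = X := by
  rw [dehom, MvPolynomial.aeval_X]; rfl

/-- [folklore] -/
private theorem dehom_X_one : dehom (MvPolynomial.X 1) = 1 := by
  rw [dehom, MvPolynomial.aeval_X]; rfl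

/-- [folklore] -/
private theorem dehom_C (a : ℝ) : dehom (MvPolynomial.C a) = C a := by
  rw [dehom, MvPolynomial.aeval_C, ← Polynomial.C_eq_algebraMap]

/-- Dehomogenising the form gives back `g` (for `deg g ≤ n`). [cite: PowersReznick2000, §3 proof
of Theorem 6, eq. (6) (p. 4684)] -/
private theorem dehom_polyaForm {n : ℕ} {g : ℝ[X]} (hg : g.natDegree ≤ n) :
    dehom (polyaForm n g) = g := by
  rw [polyaForm, map_sum]
  conv_rhs => rw [as_sum_range_C_mul_X_pow' g (Nat.lt_succ_of_le hg)]
  refine Finset.sum_congr rfl fun j _ => ?_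
  rw [map_mul, map_mul, map_pow, map_pow, dehom_C, dehom_X_zero, dehom_X_one, one_pow, mul_one]

/-- Dehomogenising `(x₀ + x₁)^N` gives `(1 + X)^N`. [folklore] -/
private theorem dehom_sum_X_pow (N : ℕ) :
    dehom ((∑ i, MvPolynomial.X i : MvPolynomial (Fin 2) ℝ) ^ N) = (1 + X) ^ N := by
  rw [map_pow, Fin.sum_univ_two, map_add, dehom_X_zero, dehom_X_one, add_comm]

/-- A monomial dehomogenises to `C a · X^{β₀}`. [folklore] -/
private theorem dehom_monomial (β : Fin 2 →₀ ℕ) (a : ℝ) :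
    dehom (MvPolynomial.monomial β a) = C a * X ^ (β 0) := by
  rw [dehom, MvPolynomial.aeval_monomial, ← Polynomial.C_eq_algebraMap,
    Finsupp.prod_fintype _ _ (fun i => by simp), Fin.prod_univ_two]
  simp

/-- **Coefficients of a form survive dehomogenisation**: for `G` homogeneous of degree `m` and
`k ≤ m`, `coeff_k (G(X, 1)) = a_{(k, m−k)}`. [folklore] -/
private theorem coeff_dehom_of_isHomogeneous {G : MvPolynomial (Fin 2) ℝ} {m : ℕ}
    (hG : G.IsHomogeneous m) {k : ℕ} (hk : k ≤ m) :
    (dehom G).coeff k = MvPolynomial.coeff (expo k (m - k)) G := by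
  classical
  conv_lhs => rw [G.as_sum, map_sum]
  simp only [dehom_monomial, finsetSum_coeff, coeff_C_mul_X_pow]
  rw [Finset.sum_eq_single (expo k (m - k))]
  · rw [if_pos (expo_zero _ _).symm]
  · intro β hβ hne
    rw [if_neg]
    intro hkβ
    apply hne
    -- `β` has degree `m` and `β 0 = k`, hence `β = (k, m − k)`
    have hdeg : β.degree = m := by
      by_contra hd
      exact (MvPolynomial.mem_support_iff.1 hβ) (hG.coeff_eq_zero hd)
    rw [degree_fin_two] at hdeg
    rw [eq_expo β, ← hkβ]
    congr 1
    omega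
  · intro hβ
    rw [if_pos (expo_zero _ _).symm]
    exact MvPolynomial.notMem_support_iff.1 hβ

/-- **Theorem 6 with Pólya's bound (Powers–Reznick 2001 form) — effective Bernstein theorem.**
Let `deg f ≤ n`, `f ≥ λ` on `[−1, 1]`, and `|e_j| ≤ L` for all coefficients `e_j` of
`f̃ = goursat n f`.  If `(N + n)·λ > L·C(n, 2)` then `f` has a homogeneous degree-`(N + n)`
representation `f = Σ_{k ≤ N+n} cₖ (1−x)ᵏ(1+x)^{N+n−k}` with ALL `cₖ > 0`; in particular
`r(f) ≤ n + N`.  (Printed: `r(f) = n + r̃(f̃) ≤ 3n + ⌈2n²L/λ⌉` with the de Loera–Santos constant;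
«`λ` is precisely the minimum of `f` on `[−1, 1]`».)  Proof as printed: Pólya on the form
`q = Σ e_j x₀ʲ x₁^{n−j}` (which is `≥ λ` on the simplex since `q(u₀,u₁) = f(u₁−u₀)`), then
dehomogenise to `(1 + x)^N f̃` and apply the Goursat transform (§3).
[cite: PowersReznick2000, §3 Theorem 6 with Proposition 4 / Corollary 5 (pp. 4683–4684)]
[cite: PowersReznick2001, Thm 1] -/
theorem isStrictBernstein_of_le_eval {f : ℝ[X]} {n N : ℕ} (hf : f.natDegree ≤ n) {L lam : ℝ}
    (hlam : ∀ x ∈ Set.Icc (-1 : ℝ) 1, lam ≤ f.eval x) (hL : ∀ j, |(goursat n f).coeff j| ≤ L)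
    (hN : L * (n.choose 2 : ℝ) < lam * (N + n : ℝ)) : IsStrictBernstein (N + n) f := by
  set q := polyaForm n (goursat n f) with hq
  have hqhom : q.IsHomogeneous n := isHomogeneous_polyaForm n _
  have hqcoeff : ∀ β : Fin 2 →₀ ℕ, |MvPolynomial.coeff β q| ≤ L * (β.multinomial : ℝ) :=
    abs_coeff_polyaForm_le hL
  have hqpos : ∀ u ∈ stdSimplex ℝ (Fin 2), lam ≤ MvPolynomial.eval u q := by
    rintro u ⟨hu0, hu1⟩
    rw [Fin.sum_univ_two] at hu1
    rw [hq, eval_polyaForm_goursat hf hu1]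
    refine hlam _ ⟨?_, ?_⟩
    · linarith [hu0 0, hu0 1]
    · linarith [hu0 0, hu0 1]
  -- Pólya: all degree-`(N+n)` coefficients of `(x₀ + x₁)^N q` are positive
  have hpolya : ∀ k ≤ N + n, 0 < MvPolynomial.coeff (expo k (N + n - k))
      ((∑ i, MvPolynomial.X i : MvPolynomial (Fin 2) ℝ) ^ N * q) := fun k hk =>
    polya_powersReznick q hqhom hqcoeff hqpos hN _ (by rw [degree_expo]; omega)
  -- dehomogenise: `(1 + X)^N f̃ = ((x₀+x₁)^N q)(X, 1)`, coefficientwise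
  have hhom : ((∑ i, MvPolynomial.X i : MvPolynomial (Fin 2) ℝ) ^ N * q).IsHomogeneous (N + n) := by
    have h1 : (∑ i, MvPolynomial.X i : MvPolynomial (Fin 2) ℝ).IsHomogeneous 1 :=
      MvPolynomial.IsHomogeneous.sum _ _ _ fun i _ => MvPolynomial.isHomogeneous_X ℝ i
    have hN' := h1.pow N
    rw [one_mul] at hN'
    exact hN'.mul hqhom
  have hdehom : dehom ((∑ i, MvPolynomial.X i : MvPolynomial (Fin 2) ℝ) ^ N * q) =
      (1 + X) ^ N * goursat n f := by
    rw [map_mul, dehom_sum_X_pow, hq, dehom_polyaForm (natDegree_goursat_le n f)]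
  rw [isStrictBernstein_iff_coeff_mul_goursat_pos hf]
  intro k hk
  rw [← hdehom, coeff_dehom_of_isHomogeneous hhom hk]
  exact hpolya k hk

/-- **The printed bound of Theorem 6**: with `λ > 0` a lower bound of `f` on `[−1, 1]` and
`L ≥ max |e_j|`, every `r > 0` with `r ≥ 3n + 2n²L/λ` is a certificate degree with ALL coefficients
positive (so `r(f) ≤ 3n + ⌈2n²L/λ⌉`). [cite: PowersReznick2000, §3 Theorem 6 (p. 4683)]
[cite: PowersReznick2001, Thm 1] -/
theorem isStrictBernstein_of_printed_bound {f : ℝ[X]} {n : ℕ} (hf : f.natDegree ≤ n) {L lam : ℝ}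
    (hlam0 : 0 < lam) (hlam : ∀ x ∈ Set.Icc (-1 : ℝ) 1, lam ≤ f.eval x)
    (hL : ∀ j, |(goursat n f).coeff j| ≤ L) {r : ℕ} (hr0 : 0 < r)
    (hr : (3 * n : ℝ) + 2 * n ^ 2 * L / lam ≤ r) : IsStrictBernstein r f := by
  have hL0 : 0 ≤ L := (abs_nonneg _).trans (hL 0)
  have hnr : n ≤ r := by
    have h1 : (0 : ℝ) ≤ 2 * n ^ 2 * L / lam := by positivity
    have h2 : (n : ℝ) ≤ r := by linarith
    exact_mod_cast h2
  obtain ⟨N, rfl⟩ : ∃ N, r = N + n := ⟨r - n, by omega⟩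
  refine isStrictBernstein_of_le_eval hf hlam hL ?_
  have hchoose : (n.choose 2 : ℝ) ≤ (n : ℝ) ^ 2 := by exact_mod_cast Nat.choose_le_pow n 2
  have hmul : lam * (3 * n + 2 * n ^ 2 * L / lam) = 3 * n * lam + 2 * n ^ 2 * L := by
    field_simp
  have h1 : lam * ((3 * n : ℝ) + 2 * n ^ 2 * L / lam) ≤ lam * ((N + n : ℕ) : ℝ) :=
    mul_le_mul_of_nonneg_left hr hlam0.le
  rw [hmul] at h1
  push_cast at h1 ⊢
  rcases Nat.eq_zero_or_pos n with rfl | hn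
  · simp only [Nat.choose_zero_succ, Nat.cast_zero, mul_zero, add_zero]
    have : (0 : ℝ) < N := by exact_mod_cast (show 0 < N by omega)
    positivity
  · have hn' : (0 : ℝ) < n := by exact_mod_cast hn
    nlinarith [mul_le_mul_of_nonneg_left hchoose hL0]

/-! ### §5 Hermite's question: Goursat's example `x² + ε` -/

/-- The Goursat transform of `p_ε = x² + ε`: «`p̃_ε(x) = ε(1 + x)² + (1 − x)² = (1 + ε) − (2 − 2ε)x
+ (1 + ε)x²`». [cite: PowersReznick2000, §2 (p. 4680)] -/
theorem goursat_two_sq_add_C (ε : ℝ) :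
    goursat 2 (X ^ 2 + C ε) = C (1 + ε) + C (2 * ε - 2) * X + C (1 + ε) * X ^ 2 := by
  simp only [goursat, Finset.sum_range_succ, Finset.sum_range_zero, coeff_add, coeff_X_pow, coeff_C,
    map_add, map_sub, map_mul, map_ofNat]
  norm_num
  ring

/-- `p_ε = x² + ε > 0` on `[−1, 1]` (indeed everywhere) for `ε > 0`: «Clearly, if `ε > 0`, then
`p_ε ∈ Pd([−1, 1])`». [cite: PowersReznick2000, §2 (p. 4680)] -/
theorem eval_sq_add_C_pos {ε : ℝ} (hε : 0 < ε) (x : ℝ) : 0 < (X ^ 2 + C ε : ℝ[X]).eval x := by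
  rw [eval_add, eval_pow, eval_X, eval_C]
  positivity

/-- **Goursat's answer to Hermite's question**: «`p_ε ∈ P_2` if and only if the coefficients of `p̃_ε`
are nonnegative, and this is true only for `ε ≥ 1`. Thus, for `0 < ε < 1`, `p_ε` provides a negative
answer» — a polynomial positive on `[−1, 1]` of degree `2` with NO degree-`2` certificate.
[cite: PowersReznick2000, §2 (p. 4680)] -/
theorem isBernstein_two_sq_add_C_iff (ε : ℝ) : IsBernstein 2 (X ^ 2 + C ε) ↔ 1 ≤ ε := by
  have hdeg : (X ^ 2 + C ε : ℝ[X]).natDegree ≤ 2 :=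
    (natDegree_add_le _ _).trans (max_le (natDegree_X_pow_le 2) (by rw [natDegree_C]; norm_num))
  rw [isBernstein_iff_coeff_nonneg hdeg, goursat_two_sq_add_C]
  constructor
  · intro h
    have h1 := h 1 (by norm_num)
    simp only [coeff_add, coeff_C_mul_X, coeff_C_mul_X_pow, coeff_C_succ] at h1
    norm_num at h1
    linarith
  · intro hε k hk
    interval_cases k <;>
      simp only [coeff_add, coeff_C_mul_X, coeff_C_mul_X_pow, coeff_C_zero, coeff_C_succ] <;>
      norm_num <;> linarith

/-- The effective theorem on the example: for `0 < ε ≤ 1` the Goursat coefficients are bounded by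
`L = 2`, the minimum on `[−1, 1]` is `ε`, `C(2,2) = 1`, so **`p_ε ∈ P_{N+2}` (all coefficients `> 0`)
as soon as `(N + 2)ε > 2`** — `r(p_ε) ≤ ⌊2/ε⌋ + 1` (the true value is the least odd integer
`≥ 1/ε`, p. 4684). [cite: PowersReznick2000, §2 (p. 4680) and §3 Theorem 6, Example (p. 4684)]
[cite: PowersReznick2001, Thm 1] -/
theorem isStrictBernstein_sq_add_C {ε : ℝ} (hε : 0 < ε) (hε1 : ε ≤ 1) {N : ℕ}
    (hN : 2 < (N + 2 : ℝ) * ε) : IsStrictBernstein (N + 2) (X ^ 2 + C ε) := by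
  have hdeg : (X ^ 2 + C ε : ℝ[X]).natDegree ≤ 2 :=
    (natDegree_add_le _ _).trans (max_le (natDegree_X_pow_le 2) (by rw [natDegree_C]; norm_num))
  refine isStrictBernstein_of_le_eval hdeg (L := 2) (lam := ε) (fun x _ => ?_) (fun j => ?_) ?_
  · rw [eval_add, eval_pow, eval_X, eval_C]
    nlinarith [sq_nonneg x]
  · rw [goursat_two_sq_add_C]
    rcases Nat.lt_or_ge j 3 with hj | hj
    · interval_cases j <;>
        simp only [coeff_add, coeff_C_mul_X, coeff_C_mul_X_pow, coeff_C_zero, coeff_C_succ] <;>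
        norm_num <;> rw [abs_le] <;> constructor <;> linarith
    · rw [coeff_eq_zero_of_natDegree_lt, abs_zero]
      · norm_num
      · refine lt_of_le_of_lt ?_ hj
        refine (natDegree_add_le _ _).trans (max_le ((natDegree_add_le _ _).trans (max_le ?_ ?_)) ?_)
        · rw [natDegree_C]; norm_num
        · exact (natDegree_C_mul_le _ _).trans (natDegree_X_le.trans (by norm_num))
        · exact (natDegree_C_mul_le _ _).trans (natDegree_X_pow_le 2)
  · norm_num
    linarith

/-! ### §6 The Bernstein basis on `[0, 1]`: completeness of sign certificates under degree elevation -/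

/-- Transport of a certificate term from `[−1, 1]` to `[0, 1]` (`x = 2y − 1`):
`c (1−x)ᵏ(1+x)ᵐ ∘ (2y − 1) = c·2^{k+m} (1−y)ᵏ yᵐ`. [folklore] -/
private theorem term_comp (c : ℝ) (k m : ℕ) :
    (C c * (1 - X) ^ k * (1 + X) ^ m : ℝ[X]).comp (C 2 * X - 1) =
      C (c * 2 ^ (k + m)) * (1 - X) ^ k * X ^ m := by
  simp only [mul_comp, pow_comp, sub_comp, add_comp, one_comp, X_comp, C_comp, map_mul, map_pow,
    map_ofNat]
  have h1 : (1 - (2 * X - 1) : ℝ[X]) = 2 * (1 - X) := by ring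
  have h2 : (1 + (2 * X - 1) : ℝ[X]) = 2 * X := by ring
  rw [h1, h2, mul_pow, mul_pow, pow_add]
  ring

/-- Mathlib's Bernstein basis polynomial with the binomial written as a constant:
`bernsteinPolynomial ℝ (k + m) k = C((k+m).choose k) · X^k · (1 − X)^m`. [folklore] -/
private theorem bernsteinPolynomial_eq (k m : ℕ) :
    bernsteinPolynomial ℝ (k + m) k = C (((k + m).choose k : ℕ) : ℝ) * X ^ k * (1 - X) ^ m := by
  rw [bernsteinPolynomial, Nat.add_sub_cancel_left, map_natCast]

/-- **Completeness of Bernstein sign certificates on `[0, 1]`** (Bernstein 1915 / Hausdorff 1921 via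
Theorem 6): if `g > 0` on `[0, 1]` then for every sufficiently large `N` the expansion of `g` in the
Bernstein basis of degree `N` has ALL coefficients strictly positive,
`g = Σ_{ν ≤ N} b_ν · bernsteinPolynomial ℝ N ν`, `b_ν > 0` — so the range-enclosure test «all
Bernstein coefficients `> 0` ⇒ `g > 0`» (tree file `BernsteinRangeEnclosure.lean`) succeeds after
degree elevation; the threshold is the explicit one of `isStrictBernstein_of_le_eval` for
`f(x) = g((1 + x)/2)`. [cite: PowersReznick2000, §2 (p. 4680, Bernstein's theorem) and §3 Theorem 6
(pp. 4683–4684)] [cite: PowersReznick2001, Thm 1] -/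
theorem exists_forall_pos_bernstein_coeff {g : ℝ[X]} (hg : ∀ y ∈ Set.Icc (0 : ℝ) 1, 0 < g.eval y) :
    ∃ N₀ : ℕ, ∀ N, N₀ ≤ N → ∃ b : ℕ → ℝ, (∀ ν ≤ N, 0 < b ν) ∧
      g = ∑ ν ∈ Finset.range (N + 1), b ν • bernsteinPolynomial ℝ N ν := by
  -- pull back to `[−1, 1]`: `f(x) = g((1 + x)/2)`
  set n := g.natDegree with hn
  set φ : ℝ[X] := C (1 / 2 : ℝ) * X + C (1 / 2) with hφ
  set f := g.comp φ with hfdef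
  have hφdeg : φ.natDegree ≤ 1 := by
    rw [hφ]
    refine (natDegree_add_le _ _).trans (max_le ?_ (by rw [natDegree_C]; exact Nat.zero_le _))
    exact (natDegree_C_mul_le _ _).trans natDegree_X_le
  have hfdeg : f.natDegree ≤ n := by
    refine natDegree_comp_le.trans ?_
    calc g.natDegree * φ.natDegree ≤ g.natDegree * 1 := Nat.mul_le_mul_left _ hφdeg
      _ = n := by rw [mul_one]
  have hfeval : ∀ x, f.eval x = g.eval ((1 + x) / 2) := fun x => by
    rw [hfdef, eval_comp, hφ]
    simp only [eval_add, eval_mul, eval_C, eval_X]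
    ring_nf
  have hfpos : ∀ x ∈ Set.Icc (-1 : ℝ) 1, 0 < f.eval x := fun x hx => by
    rw [hfeval]
    exact hg _ ⟨by linarith [hx.1], by linarith [hx.2]⟩
  -- `λ = min f > 0` on the compact interval, `L = Σ |e_j|`
  obtain ⟨x₀, hx₀, hmin⟩ := (isCompact_Icc (a := (-1 : ℝ)) (b := 1)).exists_isMinOn
    (Set.nonempty_Icc.2 (by norm_num)) f.continuous.continuousOn
  set lam := f.eval x₀ with hlam
  have hlam0 : 0 < lam := hfpos x₀ hx₀
  have hlamle : ∀ x ∈ Set.Icc (-1 : ℝ) 1, lam ≤ f.eval x := fun x hx => (isMinOn_iff.1 hmin) x hx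
  set L := ∑ j ∈ Finset.range (n + 1), |(goursat n f).coeff j| with hL
  have hLj : ∀ j, |(goursat n f).coeff j| ≤ L := by
    intro j
    by_cases hj : j ≤ n
    · exact Finset.single_le_sum (f := fun j => |(goursat n f).coeff j|) (fun _ _ => abs_nonneg _)
        (Finset.mem_range.2 (Nat.lt_succ_of_le hj))
    · rw [coeff_eq_zero_of_natDegree_lt (lt_of_le_of_lt (natDegree_goursat_le n f) (not_le.1 hj)),
        abs_zero]
      exact Finset.sum_nonneg fun _ _ => abs_nonneg _
  -- the threshold
  obtain ⟨N₁, hN₁⟩ := exists_nat_gt (L * (n.choose 2 : ℝ) / lam)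
  refine ⟨N₁ + n, fun M hM => ?_⟩
  obtain ⟨N, rfl⟩ : ∃ N, M = N + n := ⟨M - n, by omega⟩
  have hN : L * (n.choose 2 : ℝ) < lam * (N + n : ℝ) := by
    rw [div_lt_iff₀ hlam0] at hN₁
    have : (N₁ : ℝ) ≤ N + n := by exact_mod_cast (show N₁ ≤ N + n by omega)
    nlinarith
  obtain ⟨c, hc, hfc⟩ := isStrictBernstein_of_le_eval hfdeg hlamle hLj hN
  -- transport back: `g = f ∘ (2y − 1)`
  have hgf : g = f.comp (C 2 * X - 1) := by
    rw [hfdef, comp_assoc, hφ]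
    have : (C (1 / 2 : ℝ) * X + C (1 / 2)).comp (C 2 * X - 1) = (X : ℝ[X]) := by
      simp only [add_comp, mul_comp, C_comp, X_comp]
      rw [show C (1 / 2 : ℝ) * (C 2 * X - 1) + C (1 / 2) = (C (1 / 2 : ℝ) * C 2) * X by ring,
        ← map_mul, show (1 / 2 : ℝ) * 2 = 1 by norm_num, map_one, one_mul]
    rw [this, comp_X]
  refine ⟨fun ν => c (N + n - ν) * 2 ^ (N + n) / ((N + n).choose ν : ℝ), fun ν hν => ?_, ?_⟩
  · exact div_pos (mul_pos (hc _ (Nat.sub_le _ _)) (pow_pos two_pos _))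
      (by exact_mod_cast Nat.choose_pos hν)
  · rw [hgf, hfc, bernsteinCert, Polynomial.sum_comp]
    rw [← Finset.sum_range_reflect _ (N + n + 1)]
    refine Finset.sum_congr rfl fun k hk => ?_
    have hkM : k ≤ N + n := Nat.lt_succ_iff.mp (Finset.mem_range.mp hk)
    obtain ⟨m, hm⟩ := Nat.exists_eq_add_of_le hkM
    -- the reflected index: the `k`-th Bernstein basis element comes from the term `m = N + n − k`
    rw [show N + n + 1 - 1 - k = m by omega, term_comp, show N + n - m = k by omega, Nat.add_comm m k,
      hm]
    dsimp only
    rw [Nat.add_sub_cancel_left, smul_eq_C_mul, bernsteinPolynomial_eq, ← mul_assoc, ← mul_assoc,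
      ← map_mul]
    have hch : (((k + m).choose k : ℕ) : ℝ) ≠ 0 := by exact_mod_cast (Nat.choose_pos (by omega)).ne'
    rw [div_mul_cancel₀ _ hch]
    ring

end Literature.Algebra.Polynomial.BernsteinDegree

end
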